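import Summits.RiemannHypothesis.RiemannHypothesis.Theorems.GroundBartaEvenWinsBeyondArchDeflationShellBound
import Summits.RiemannHypothesis.RiemannHypothesis.Theorems.GroundBartaEvenWinsBeyondArchDeflationCertBridgeWX
import HarnessLib

/-!
# RiemannHypothesis / GroundBarta — rung 4 (`EvenWinsBeyondArch`, stmt-RiemannHypothesis-18807 / 18085):
# the endpoint cell — the weighted residual Gram matrix of the EXTENDED images from the standard R-layer plus the thin shell

Helper file (`--supports stmt-RiemannHypothesis-18085`), RH-free, Mathlib + landed tree files only, no definitions, no named
facts.  Prover B (gen 6 of unit `sr-gb-rung-b`).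

The endpoint bridge `dt_weil{Odd,Even}GroundEnergy_ge_of_deflCert_wxa` wants the weighted residual Gram matrix of the
EXTENDED images `Fx_i` (indicator `[-b, b]`), while the R-layer certificate (prover B's generator, unchanged) delivers it for the
standard window-`c'` images `F_i` of the same cut vectors `v_i = 𝟙_{[-c',c']}g_i`.  The two residuals `Fx_i − ΣWv` and
`F_i − ΣWv` coincide off the shell `S = {c' < |y| ≤ b}`; on `S` the former is the bare image, the latter vanishes.  Hence
(`dt_shell_wgram_bounds`) every weighted Gram entry moves by at most `C_w G_i G_j · Sh`, `G_i = sup|g_i|`,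
`Sh = 4δ(K + (3/2)log(1/δ))² + 288δ`, `δ = b − c'` (…ShellBound) — for the endpoint cell `δ = 10⁻²⁵`, `Sh ≈ 4·10⁻²¹`.
-/

set_option linter.dupNamespace false

noncomputable section

open MeasureTheory Set Filter
open scoped Topology ENNReal NNReal ComplexConjugate BigOperators

namespace Summit.RiemannHypothesis.RiemannHypothesis.Theorems.EvenWinsBeyondArch

open Literature.NumberTheory.LFunctions

/-- **Shell correction of the weighted residual Gram matrix.**  For cut vectors `v_i = 𝟙_{[-c',c']}g_i` (`g_i ∈ C²`,
`|g_i| ≤ G_i` on the window), their window-`c'` images `F_i` and extended images `Fx_i` (indicator `[-b,b]`, `0 < c' < b`,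
`b − c' ≤ 1`, prime index and killing constant of `c'`), any `W` and any bounded measurable weight `|w| ≤ C_w`:
`|∫ w Re((Fx_i − ΣWv)(Fx_j − ΣWv)^*) − ∫ w Re((F_i − ΣWv)(F_j − ΣWv)^*)| ≤ C_w G_i G_j Sh` whenever
`K ≥ 4c'(cosh(c'/2)cosh(b/2) + sinh(c'/2)sinh(b/2)) + 2Σ_{n∈weilPrimeIndex c'}Λ(n)n^{-1/2} + 2∫_1^∞ρ` and
`Sh ≥ 4(b−c')(K + (3/2)log(1/(b−c')))² + 288(b−c')`. [folklore] -/
theorem dt_shell_wgram_bounds {c' b : ℝ} (hc' : 0 < c') (hcb : c' < b) (hδ1 : b - c' ≤ 1) {k : ℕ}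
    (g : Fin k → ℝ → ℝ) (hg : ∀ i, ContDiff ℝ 2 (g i)) (Gs : Fin k → ℝ)
    (hG : ∀ i, ∀ x ∈ Icc (-c') c', |g i x| ≤ Gs i)
    (v F Fx : Fin k → ℝ → ℂ) (hv : ∀ i x, v i x = (((Icc (-c') c').indicator (g i) x : ℝ) : ℂ))
    (hF : ∀ i y, F i y = (Icc (-c') c').indicator (fun y ↦
        2 * (∫ x, v i x * (Real.cosh (x / 2) : ℂ)) * (Real.cosh (y / 2) : ℂ) -
          2 * (∫ x, v i x * (Real.sinh (x / 2) : ℂ)) * (Real.sinh (y / 2) : ℂ) +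
        (∑ m ∈ weilPrimeIndex c', (((ArithmeticFunction.vonMangoldt m : ℝ) / Real.sqrt m : ℝ) : ℂ) *
          (2 * v i y - v i (y - Real.log m) - v i (y + Real.log m))) +
        ∫ t in Ioi 0, (weilArchDensity t : ℂ) * (2 * v i y - v i (y - t) - v i (y + t))) y -
      (weilMarkovConstant c' : ℂ) * v i y)
    (hFx : ∀ i y, Fx i y = (Icc (-b) b).indicator (fun y ↦
        2 * (∫ x, v i x * (Real.cosh (x / 2) : ℂ)) * (Real.cosh (y / 2) : ℂ) -
          2 * (∫ x, v i x * (Real.sinh (x / 2) : ℂ)) * (Real.sinh (y / 2) : ℂ) +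
        (∑ m ∈ weilPrimeIndex c', (((ArithmeticFunction.vonMangoldt m : ℝ) / Real.sqrt m : ℝ) : ℂ) *
          (2 * v i y - v i (y - Real.log m) - v i (y + Real.log m))) +
        ∫ t in Ioi 0, (weilArchDensity t : ℂ) * (2 * v i y - v i (y - t) - v i (y + t))) y -
      (weilMarkovConstant c' : ℂ) * v i y)
    (W : Fin k → Fin k → ℝ) {w : ℝ → ℝ} (hwm : Measurable w) {Cw : ℝ} (hwC : ∀ y, |w y| ≤ Cw)
    {K Sh : ℝ}
    (hK : 4 * c' * (Real.cosh (c' / 2) * Real.cosh (b / 2) + Real.sinh (c' / 2) * Real.sinh (b / 2)) +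
        2 * (∑ n ∈ weilPrimeIndex c', (ArithmeticFunction.vonMangoldt n : ℝ) / Real.sqrt n) +
        2 * (∫ t in Ici 1, weilArchDensity t) ≤ K)
    (hSh : 4 * (b - c') * (K + 3 / 2 * (-Real.log (b - c'))) ^ 2 + 288 * (b - c') ≤ Sh) (i j : Fin k) :
    |(∫ y, w y * ((Fx i - ∑ l, W i l • v l) y * conj ((Fx j - ∑ l, W j l • v l) y)).re) -
        ∫ y, w y * ((F i - ∑ l, W i l • v l) y * conj ((F j - ∑ l, W j l • v l) y)).re| ≤
      Cw * Gs i * Gs j * Sh := by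
  have hcb' : c' ≤ b := hcb.le
  have hb0 : 0 < b := hc'.trans hcb
  have hCw : 0 ≤ Cw := (abs_nonneg _).trans (hwC 0)
  have hG0 : ∀ i, 0 ≤ Gs i := fun i ↦ (abs_nonneg _).trans (hG i 0 ⟨by linarith, by linarith⟩)
  -- the bare images
  set T : Fin k → ℝ → ℂ := fun i y ↦
    2 * (∫ x, v i x * (Real.cosh (x / 2) : ℂ)) * (Real.cosh (y / 2) : ℂ) -
      2 * (∫ x, v i x * (Real.sinh (x / 2) : ℂ)) * (Real.sinh (y / 2) : ℂ) +
    (∑ m ∈ weilPrimeIndex c', (((ArithmeticFunction.vonMangoldt m : ℝ) / Real.sqrt m : ℝ) : ℂ) *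
      (2 * v i y - v i (y - Real.log m) - v i (y + Real.log m))) +
    ∫ t in Ioi 0, (weilArchDensity t : ℂ) * (2 * v i y - v i (y - t) - v i (y + t)) with hT
  -- the non-negative constants
  have hS0 : 0 ≤ ∑ n ∈ weilPrimeIndex c', (ArithmeticFunction.vonMangoldt n : ℝ) / Real.sqrt n :=
    Finset.sum_nonneg fun n _ ↦ div_nonneg ArithmeticFunction.vonMangoldt_nonneg (Real.sqrt_nonneg _)
  have hC₁0 : 0 ≤ ∫ t in Ici (1 : ℝ), weilArchDensity t :=
    setIntegral_nonneg measurableSet_Ici fun t (ht : 1 ≤ t) ↦ (weilArchDensity_pos (by linarith)).le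
  have hK0 : 0 ≤ K := by
    have : 0 ≤ 4 * c' * (Real.cosh (c' / 2) * Real.cosh (b / 2) + Real.sinh (c' / 2) * Real.sinh (b / 2)) := by
      have h1 := Real.cosh_pos (c' / 2); have h2 := Real.cosh_pos (b / 2)
      have h3 : 0 ≤ Real.sinh (c' / 2) := Real.sinh_nonneg_iff.2 (by linarith)
      have h4 : 0 ≤ Real.sinh (b / 2) := Real.sinh_nonneg_iff.2 (by linarith)
      positivity
    linarith
  -- pointwise bound of the bare images on the shell
  have hTle : ∀ i y, c' < |y| → |y| ≤ b → ‖T i y‖ ≤ Gs i * (K + 3 / 2 * max 0 (-Real.log (|y| - c'))) := by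
    intro i y hy1 hy2
    have h := dt_shell_image_norm_le hc' (hg i).continuous (hG i) (hv i) hy1 hy2
    have hm0 : 0 ≤ max 0 (-Real.log (|y| - c')) := le_max_left _ _
    calc ‖T i y‖ ≤ _ := h
      _ ≤ Gs i * (K + 3 / 2 * max 0 (-Real.log (|y| - c'))) := by
          refine mul_le_mul_of_nonneg_left ?_ (hG0 i); linarith
  -- vectors off the cut
  have hvout : ∀ l y, y ∉ Icc (-c') c' → v l y = 0 := fun l y hy ↦ by rw [hv l y, indicator_of_notMem hy]; simp
  -- residuals in `L²`
  have hvM : ∀ i, MemLp (v i) 2 := fun i ↦ by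
    have e : v i = fun x ↦ (((Icc (-c') c').indicator (g i) x : ℝ) : ℂ) := funext (hv i)
    rw [e]; exact (dt_indicator_mul_mem_formDomain hc' ((hg i).of_le (by norm_num))).1
  have hr : ∀ i, MemLp (F i - ∑ l, W i l • v l) 2 := by
    intro i
    obtain ⟨m, hm, -, hHm⟩ := dt_exists_majorant_of_contDiff hc' (hg i) (hv i)
    exact (dt_windowImage_memLp (hvM i) hm hHm (hF i)).sub (memLp_finsetSum' _ fun l _ ↦ (hvM l).const_smul _)
  have hrx : ∀ i, MemLp (Fx i - ∑ l, W i l • v l) 2 := by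
    intro i
    obtain ⟨m, hm, hH⟩ := dt_exists_majorant_of_contDiff_cut hc' hcb' (hg i) (hv i)
    exact (dt_windowImageX_memLp (hvM i) hm hH (weilPrimeIndex c') (weilMarkovConstant c') (hFx i)).sub
      (memLp_finsetSum' _ fun l _ ↦ (hvM l).const_smul _)
  -- the shell and the pointwise identity
  set S : Set ℝ := {y : ℝ | c' < |y| ∧ |y| ≤ b} with hS
  have hSm : MeasurableSet S :=
    (measurableSet_lt measurable_const continuous_abs.measurable).inter
      (measurableSet_le continuous_abs.measurable measurable_const)
  set f : ℝ → ℝ := fun y ↦ w y * ((Fx i - ∑ l, W i l • v l) y * conj ((Fx j - ∑ l, W j l • v l) y)).re with hf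
  set f₀ : ℝ → ℝ := fun y ↦ w y * ((F i - ∑ l, W i l • v l) y * conj ((F j - ∑ l, W j l • v l) y)).re with hf₀
  have hrxS : ∀ i, ∀ y ∈ S, (Fx i - ∑ l, W i l • v l) y = T i y := by
    intro i y hy
    have hyb : y ∈ Icc (-b) b := ⟨by linarith [neg_abs_le y, hy.2], (le_abs_self y).trans hy.2⟩
    have hvy : ∀ l, v l y = 0 := fun l ↦ hvout l y fun h ↦ by
      have : |y| ≤ c' := abs_le.2 ⟨h.1, h.2⟩; linarith [hy.1]
    simp only [Pi.sub_apply, Finset.sum_apply, Pi.smul_apply, hFx i y, indicator_of_mem hyb, hvy, smul_zero,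
      Finset.sum_const_zero, mul_zero, sub_zero, hT]
  have hrS : ∀ i, ∀ y ∈ S, (F i - ∑ l, W i l • v l) y = 0 := by
    intro i y hy
    have hyc : y ∉ Icc (-c') c' := fun h ↦ by have : |y| ≤ c' := abs_le.2 ⟨h.1, h.2⟩; linarith [hy.1]
    have hvy : ∀ l, v l y = 0 := fun l ↦ hvout l y hyc
    simp only [Pi.sub_apply, Finset.sum_apply, Pi.smul_apply, hF i y, indicator_of_notMem hyc, hvy, smul_zero,
      Finset.sum_const_zero, mul_zero, sub_zero]
  have hroff : ∀ i, ∀ y ∉ S, (Fx i - ∑ l, W i l • v l) y = (F i - ∑ l, W i l • v l) y := by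
    intro i y hy
    simp only [Pi.sub_apply, hFx i y, hF i y]
    by_cases hyc : y ∈ Icc (-c') c'
    · have hyb : y ∈ Icc (-b) b := Icc_subset_Icc (by linarith) hcb' hyc
      rw [indicator_of_mem hyb, indicator_of_mem hyc]
    · have hyb : y ∉ Icc (-b) b := by
        intro h
        have h1 : c' < |y| := by
          by_contra hle
          exact hyc (abs_le.1 (not_lt.1 hle) |> fun h' ↦ ⟨by linarith [h'.1], h'.2⟩)
        exact hy ⟨h1, abs_le.2 ⟨h.1, h.2⟩⟩
      rw [indicator_of_notMem hyb, indicator_of_notMem hyc]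
  have hpt : ∀ y, f y = f₀ y + S.indicator (fun y ↦ w y * (T i y * conj (T j y)).re) y := by
    intro y
    by_cases hy : y ∈ S
    · rw [indicator_of_mem hy, hf, hf₀]; dsimp only
      rw [hrxS i y hy, hrxS j y hy, hrS i y hy, hrS j y hy]; simp
    · rw [indicator_of_notMem hy, hf, hf₀]; dsimp only
      rw [hroff i y hy, hroff j y hy, add_zero]
  -- integrability
  have hfi : Integrable f := dt_integrable_wpairing hwm hwC (hrx i) (hrx j)
  have hf₀i : Integrable f₀ := dt_integrable_wpairing hwm hwC (hr i) (hr j)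
  -- the shell profile is integrable on both sides
  obtain ⟨hqR, hqRle⟩ := dt_shell_profile_sq_integral_right (K := K) hc' hcb hδ1 hK0
  obtain ⟨hqL, hqLle⟩ := dt_shell_profile_sq_integral_left (K := K) hc' hcb hδ1 hK0
  set q : ℝ → ℝ := fun y ↦ (K + 3 / 2 * max 0 (-Real.log (|y| - c'))) ^ 2 with hq
  have hSsplit : S = Ioc c' b ∪ Ico (-b) (-c') := by
    ext y; simp only [hS, mem_setOf_eq, mem_union, mem_Ioc, mem_Ico]
    constructor
    · rintro ⟨h1, h2⟩
      rcases le_or_gt 0 y with h0 | h0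
      · rw [abs_of_nonneg h0] at h1 h2; exact Or.inl ⟨h1, h2⟩
      · rw [abs_of_neg h0] at h1 h2; exact Or.inr ⟨by linarith, by linarith⟩
    · rintro (⟨h1, h2⟩ | ⟨h1, h2⟩)
      · have h0 : 0 < y := hc'.trans h1
        rw [abs_of_pos h0]; exact ⟨h1, h2⟩
      · have h0 : y < 0 := by linarith
        rw [abs_of_neg h0]; exact ⟨by linarith, by linarith⟩
  have hdisj : Disjoint (Ioc c' b) (Ico (-b) (-c')) :=
    Set.disjoint_left.2 fun y hy hy' ↦ by linarith [hy.1, hy'.2]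
  have hqS : IntegrableOn q S := by rw [hSsplit]; exact hqR.union hqL
  have hqSval : ∫ y in S, q y ≤ 4 * (b - c') * (K + 3 / 2 * (-Real.log (b - c'))) ^ 2 + 288 * (b - c') := by
    rw [hSsplit, setIntegral_union hdisj measurableSet_Ico hqR hqL]
    linarith
  -- the shell term is dominated by `Cw G_i G_j q` on `S`
  have hdom : ∀ y, ‖S.indicator (fun y ↦ w y * (T i y * conj (T j y)).re) y‖ ≤
      S.indicator (fun y ↦ Cw * Gs i * Gs j * q y) y := by
    intro y
    by_cases hy : y ∈ S
    · rw [indicator_of_mem hy, indicator_of_mem hy, Real.norm_eq_abs, abs_mul]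
      have h1 : |(T i y * conj (T j y)).re| ≤ ‖T i y‖ * ‖T j y‖ := by
        refine (Complex.abs_re_le_norm _).trans ?_
        rw [norm_mul, Complex.norm_conj]
      have hTi := hTle i y hy.1 hy.2
      have hTj := hTle j y hy.1 hy.2
      have hm0 : 0 ≤ K + 3 / 2 * max 0 (-Real.log (|y| - c')) := by positivity
      have h2 : ‖T i y‖ * ‖T j y‖ ≤ Gs i * Gs j * q y := by
        calc ‖T i y‖ * ‖T j y‖ ≤ (Gs i * (K + 3 / 2 * max 0 (-Real.log (|y| - c')))) *
              (Gs j * (K + 3 / 2 * max 0 (-Real.log (|y| - c')))) :=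
              mul_le_mul hTi hTj (norm_nonneg _) (mul_nonneg (hG0 i) hm0)
          _ = Gs i * Gs j * q y := by simp only [hq]; ring
      calc |w y| * |(T i y * conj (T j y)).re| ≤ Cw * (‖T i y‖ * ‖T j y‖) :=
            mul_le_mul (hwC y) h1 (abs_nonneg _) hCw
        _ ≤ Cw * (Gs i * Gs j * q y) := mul_le_mul_of_nonneg_left h2 hCw
        _ = Cw * Gs i * Gs j * q y := by ring
    · rw [indicator_of_notMem hy, indicator_of_notMem hy, norm_zero]
  have hupS : IntegrableOn (fun y ↦ Cw * Gs i * Gs j * q y) S := hqS.const_mul _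
  have hupI : Integrable (S.indicator fun y ↦ Cw * Gs i * Gs j * q y) := hupS.integrable_indicator hSm
  -- assemble
  have hdiff : (∫ y, f y) - ∫ y, f₀ y = ∫ y, S.indicator (fun y ↦ w y * (T i y * conj (T j y)).re) y := by
    rw [← integral_sub hfi hf₀i]
    refine integral_congr_ae (Eventually.of_forall fun y ↦ ?_)
    show f y - f₀ y = S.indicator (fun y ↦ w y * (T i y * conj (T j y)).re) y
    rw [hpt y]; ring
  rw [hf, hf₀] at hdiff
  rw [hdiff]
  calc |∫ y, S.indicator (fun y ↦ w y * (T i y * conj (T j y)).re) y|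
      = ‖∫ y, S.indicator (fun y ↦ w y * (T i y * conj (T j y)).re) y‖ := (Real.norm_eq_abs _).symm
    _ ≤ ∫ y, ‖S.indicator (fun y ↦ w y * (T i y * conj (T j y)).re) y‖ := norm_integral_le_integral_norm _
    _ ≤ ∫ y, S.indicator (fun y ↦ Cw * Gs i * Gs j * q y) y :=
        integral_mono_of_nonneg (Eventually.of_forall fun y ↦ norm_nonneg _) hupI (Eventually.of_forall hdom)
    _ = Cw * Gs i * Gs j * ∫ y in S, q y := by
        rw [integral_indicator hSm, integral_const_mul]
    _ ≤ Cw * Gs i * Gs j * Sh := by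
        refine mul_le_mul_of_nonneg_left (hqSval.trans hSh) ?_
        exact mul_nonneg (mul_nonneg hCw (hG0 i)) (hG0 j)

end Summit.RiemannHypothesis.RiemannHypothesis.Theorems.EvenWinsBeyondArch

end
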